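import Literature.Algebra.EuclideanLattices.KhotGapInstancesBCH
import Literature.InformationTheory.Coding.BCHExplicitFP
import HarnessLib

/-!
# Khot 2005, Thm. 4.1 (machine level): Khot's BCH block `P_BCH` is computable in polynomial time

Topic `Algebra/EuclideanLattices`, namespace `Literature.Algebra.EuclideanLattices.Khot`. A small brick
between `KhotGapInstancesBCH.lean` (`khotBCH u σ K k = bchExplicit (20K) (MM u σ K k) (NN u σ K k)`, the
explicit `{0,1}` block with `40K`-wise independent columns used by `khotDataExplicit` /
`khotOutputExplicit`, `KhotExplicitReduction.lean`) and the one remaining MACHINE hypothesis of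
`gapSVP_const_isNPHardRandomized_of_prop6_of_FP` (`KhotReduction.lean`: some `F ∈ FP` computes
`⟨code I, c⟩ ↦ code (khotOutput k Δ I c)`): the BCH block, as the list matrix `khotBCHTab u σ K k :=
GF2X.bchTabAlg (20K) (MM u σ K k) (NN u σ K k)` (`InformationTheory/Coding/BCHExplicitFP.lean`), IS
`khotBCH` entrywise (`ent_khotBCHTab`, rows in the order `l + (M+1)·s` of `finProdFinEquiv`, the order
`idxR` of `KhotReduction.lean` uses for the BCH rows; `toMat_khotBCHTab`) — the guard `2^M ≤ N` of
`GF2X.ent_bchTabAlg` holds as `NN = 2^{MM}` — and it is computed on codes from `(1ᴷ, 1ᴹ, 1ᴺ)` by a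
polynomial-time string function (`khotBCHTabFP`, in the typed algebra `CodeFP`). All proved; no facts.

## References

* S. Khot, *Hardness of approximating the shortest vector problem in lattices*, J. ACM 52 (2005)
  789–808, Thm. 4.1 ("… and it can be constructed efficiently"), §7.3.
* S. Arora, B. Barak, *Computational Complexity: A Modern Approach*, CUP 2009, §1.3.
-/

namespace Literature.Algebra.EuclideanLattices.Khot

open Params
open Literature.Computability.Complexity Literature.Computability.Complexity.CodeFP
  Literature.Computability.Complexity.LMat
open Literature.InformationTheory.Coding.GF2X (bchTabAlg ent_bchTabAlg bchTabFP length_bchTabAlg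
  length_of_mem_bchTabAlg)

/-- **Khot's BCH block as a list-matrix program**: `20K·(M+1)` rows, `N` columns.
[cite: Khot2005, Thm. 4.1] -/
def khotBCHTab (u σ K k : ℕ) : List (List ℤ) :=
  bchTabAlg (20 * K) (MM u σ K k) (NN u σ K k)

/-- `N = 2^M` for Khot's parameters, so the guard of `ent_bchTabAlg` holds. [cite: Khot2005, §7.3] -/
theorem two_pow_MM_le_NN (u σ K k : ℕ) : 2 ^ MM u σ K k ≤ NN u σ K k := le_of_eq rfl

/-- The program has `20K·(M+1)` rows … [folklore] -/
theorem length_khotBCHTab (u σ K k : ℕ) : (khotBCHTab u σ K k).length = 20 * K * (MM u σ K k + 1) :=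
  length_bchTabAlg _ _ _

/-- … i.e. `hh u σ K k` rows (the number of BCH rows of the intermediate lattice, `KhotParameters`) …
[cite: Khot2005, §7.3] -/
theorem length_khotBCHTab_eq_hh (u σ K k : ℕ) : (khotBCHTab u σ K k).length = hh u σ K k :=
  length_khotBCHTab u σ K k

/-- … of `N` entries each. [folklore] -/
theorem length_of_mem_khotBCHTab {u σ K k : ℕ} {r : List ℤ} (h : r ∈ khotBCHTab u σ K k) :
    r.length = NN u σ K k :=
  length_of_mem_bchTabAlg h

/-- **The program computes `khotBCH`**: row `l + (M+1)·s`, column `j` of `khotBCHTab u σ K k` holds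
`khotBCH u σ K k (s, l) j`. [cite: Khot2005, Thm. 4.1] -/
theorem ent_khotBCHTab (u σ K k : ℕ) (s : Fin (20 * K)) (l : Fin (MM u σ K k + 1)) (j : Fin (NN u σ K k)) :
    ent (khotBCHTab u σ K k) ((l : ℕ) + (MM u σ K k + 1) * s) j = khotBCH u σ K k (s, l) j :=
  ent_bchTabAlg (two_pow_MM_le_NN u σ K k) s l j

/-- The same through `finProdFinEquiv` and `LMat.toMat`: the matrix of the program is `khotBCH` with
its row pairs flattened. [cite: Khot2005, Thm. 4.1] -/
theorem toMat_khotBCHTab (u σ K k : ℕ) (s : Fin (20 * K)) (l : Fin (MM u σ K k + 1)) (j : Fin (NN u σ K k)) :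
    toMat (20 * K * (MM u σ K k + 1)) (NN u σ K k) (khotBCHTab u σ K k) (finProdFinEquiv (s, l)) j =
      khotBCH u σ K k (s, l) j := by
  rw [toMat, finProdFinEquiv_apply_val]
  exact ent_khotBCHTab u σ K k s l j

/-- As a `Matrix` statement: re-indexing the rows of `khotBCH` by `finProdFinEquiv` gives the matrix
of the program. [cite: Khot2005, Thm. 4.1] -/
theorem toMat_khotBCHTab_eq (u σ K k : ℕ) :
    toMat (20 * K * (MM u σ K k + 1)) (NN u σ K k) (khotBCHTab u σ K k) =
      Matrix.reindex finProdFinEquiv (Equiv.refl _) (khotBCH u σ K k) := by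
  ext i j
  obtain ⟨⟨s, l⟩, rfl⟩ := finProdFinEquiv.surjective i
  rw [Matrix.reindex_apply, Matrix.submatrix_apply, Equiv.symm_apply_apply, Equiv.refl_symm,
    Equiv.refl_apply]
  exact toMat_khotBCHTab u σ K k s l j

/-- **Khot's BCH block is computed on codes in polynomial time**: `(1ᴷ, 1ᴹ, 1ᴺ) ↦ bchTabAlg (20K) M N`
(so `(1ᴷ, 1^{MM}, 1^{NN}) ↦ khotBCHTab u σ K k`), by `bchTabFP` after the unary product `20 · K`.
[cite: Khot2005, Thm. 4.1; AroraBarak2009, §1.3] -/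
theorem khotBCHTabFP : CodeFP (pairE unE (pairE unE unE)) matE (fun p => bchTabAlg (20 * p.1) p.2.1 p.2.2) := by
  have h20 : CodeFP (pairE unE (pairE unE unE)) unE (fun p => 20 * p.1) :=
    ((ulength unitE).comp (unitsMul.comp ((const _ (List.replicate 20 ())).pair
      (replicateUnit.comp (fst _ _))))).congr fun p => by simp
  exact bchTabFP.comp (h20.pair (snd _ _))

/-- The program named: `(1ᴷ, 1^{MM}, 1^{NN}) ↦ khotBCHTab u σ K k` is the value of the polynomial-time
function of `khotBCHTabFP` (definitional unfolding, for use with `CodeFP.congr`). [folklore] -/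
theorem khotBCHTab_eq (u σ K k : ℕ) : khotBCHTab u σ K k = bchTabAlg (20 * K) (MM u σ K k) (NN u σ K k) := rfl

end Literature.Algebra.EuclideanLattices.Khot
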